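import Literature.Probability.Percolation.MarkedLoopLawContract
import Literature.Probability.Percolation.MarkedLoopLawSlideOfDarts
import HarnessLib

/-!
# F2 for constructed domains: the law of `(Ω ∪ h; M)` is the law of `(Ω; M)` plus the contraction of the law of `(Ω; M + p + q)` («CONTRACT-OF-DARTS»)

Topic `Literature/Probability/Percolation`; the constructor companion of `MarkedLoopLawContract.lean` («LAW-CONTRACT»: F2 `lawLP z' = lawLP z + contractL j (lawLP z_E)` for an
`AttachData D' D h r m` and a `MarksData D E h r m j`), exactly as `MarkedLoopLawSlideOfDarts.lean` («SLIDE-OF-DARTS») is the constructor companion of the SLIDE identity: from the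
SAME coordinate datum `SlideDarts D₀ D₀' h r m bz S₀` (two unmarked discrete domains `G ⊂ G' = G ∪ {h}`, `h` attached along the contact arc `k > m`, `1 ≤ m ≤ 3`, first contact
end simple; common marks `S₀`; a flat common observed dart `bz`) and a size `#S₀ = n + 1`, it BUILDS the three marked domains of F2 with Bollobás–Riordan's marking of discrete
domains at boundary darts (`TriMarkedDomain.ofDarts`):

* `dom0 = (Ω; M)` — `G` marked at `S₀`; `dom0' = (Ω ∪ h; M)` — `G'` marked at `S₀`; `domPQ = (Ω; M + p + q)` — `G` marked at `S₀ ∪ {dP, dQ}` (`dP = slideP h r` the mark at the first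
  contact end `P = N_{r+5}`, `dQ = slideQ h r m` the mark at the last contact end `Q = N_{r+m}`; `card_insert₂`, `markable₂`, `injOn₂`);
* ★ `markDart_dom0'_eq`, `predDart_dom0'_eq`, `yc_dom0'_eq` — `D'` and `D` have the same marks and the same corner faces («ATTACH-ORDER»: common darts compare identically;
  the predecessor dart of a common mark avoids the notch); ★★ `attachData : AttachData dom0' dom0 h r m`;
* `jIns` — **THE INSERTION INDEX** `j` (the number of common marks numbered before `dP`); ★ `dpos_markDart_lt_dP_iff` (a common mark is before `dP` iff its index is `< j`);
  `dpos_dP_lt_dQ` (`dP` strictly before `dQ`, and NO common mark between them — «SLIDE-OF-DARTS» `dpos_lt_dQ_iff_lt_dP`); `insFun`, `insFun_strictMono`, ★★ `markDart_domPQ` /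
  `markDart_domPQ_eq` — **the marks of `E` are `dP` at `j`, `dQ` at `j+1`, the common marks at `skip j`**;
* ★ `yc_domPQ_skip`, ★ `yc_domPQ_ends` (the new corner faces ARE `P = N_{r+5}` and `Q = N_{r+m}`), ★★ `marksData : MarksData dom0 domPQ h r m jIns`;
* `bz_mem_stretch₀` (the observed dart is on the home stretch of all three), `arcPoint0`, `arcPoint0'`, `arcPointPQ`, `arcPoint_v_i₀`;
* ★★★★ `SlideDarts.lawLP_eq_add_contractL` — **F2, CONSTRUCTED: `lawLP z(Ω ∪ h; M) = lawLP z(Ω; M) + contractL ℂ j⁺ (lawLP z(Ω; M + p + q))`.**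

So for one and the same datum the lane now has BOTH surgery identities as theorems about constructed lawpoints: SLIDE (`SlideDarts.lawLP_eq_add`, moving the mark `q ↦ a`)
and F2 (this file, attaching the hexagon with no mark) — the BR-compatible algebra of HOME `FINDING-BSPAN-TOWER-IDENTITY.md` / `FINDING-TWO-CELL-CAP-IDENTITY.md`.

## References
* M. Khristoforov, S. Smirnov, *Percolation and O(1) loop model*, arXiv:2111.15612v1 (2021), §1.2 (p. 2: the law of the link pattern; disorders on the boundary), §2
  Definition 3 and Remark 6 (pp. 4–5: boundary mid-edges).
* P. A. Pearce, V. Rittenberg, J. de Gier, B. Nienhuis, *Temperley–Lieb stochastic processes*, J. Phys. A 35 (2002) L661–L668, §2 ((monoid): contraction at `j, j+1`).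
* B. Bollobás, O. Riordan, *Percolation*, Cambridge University Press 2006, Ch. 7 §7.2.2 pp. 168–169 (discrete domains, marked boundary sites in anticlockwise order).

## Mathlib / tree
Tree: `MarkedLoopLawSlideOfDarts` (`SlideDarts`, `slideP/Q`, `isMarkable_dP/dQ`, `dpos_lt_dQ_iff_lt_dP`, `removableAt`, `verts_eq_erase`, `dQ_eq_dPlus`, `bz_mem'`,
`mem'_of_mem`, `dP_da_not_mem`, `leftFaceDir_contactQ`), `MarkedLoopLawContract` (`AttachData.lawLP_eq_add_contractL_lawLP`, `MarksData`, `eq_castSucc_or_succ_or_skip`),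
`TriMarkedDomainAttach` (`rebase₀`, `ofDarts_markDart_eq_of_orderIso/strictMono`, `dpos_ofDarts_markDart`, `dpos_lt_dpos_iff_of_common`, `predDart_eq_of_succ_eq`,
`yc_eq_leftFaceDir`), `TriMarkedDomainOfDarts(Stretch)` (`ofDarts`, `ofDarts_markDart_mem`, `dartPos_strictMono`, `mem_stretch_ofDarts_last_iff`), `TriMarkedRingLocal`
(`RemovableAt.succ_erase_nw/_nw_last/_dMinus/_eq`), `MarkedLoopArcPointOfDart` (`ArcPoint.ofFlatDart`), `LatticeModels/TemperleyLiebCapContract` (`skip`, `unskip`,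
`skip_val`, `skip_lt_iff`). Mathlib: `Fin.card_Iic`, `Fin.card_Iio`, `Finset.card_le_card`.
-/


open Finset

namespace Literature.Probability.Percolation.MarkedLoops

open Literature.Probability.Percolation Literature.Probability.LatticeModels
open Literature.Probability.LatticeModels.TemperleyLieb
open Literature.Probability.Percolation.FivePoint (side side_injective)
open TriMarkedDomain

section ContractOfDarts

variable {D₀ D₀' : TriMarkedDomain 0} {h : Site 2} {r m : Fin 6} {bz : Site 2 × Site 2} {S₀ : Finset (Site 2 × Site 2)}

namespace SlideDarts

variable (T : SlideDarts D₀ D₀' h r m bz S₀)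
include T

omit T in
/-- `Fin 6` facts for `m ≤ 3`. [cite: BollobasRiordan2006, Ch. 7 §7.2.2 p. 168; lane plumbing] -/
private theorem finm₉ (m : Fin 6) (hm : m.val ≤ 3) : (m + 1).val = m.val + 1 ∧ m < m + 1 ∧ (5 : Fin 6) ≠ m + 1 ∧ m.val ≤ 4 ∧ m + 1 + 5 = m := by
  revert hm; revert m; decide

omit T in
/-- `Fin 6` constants. [cite: BollobasRiordan2006, Ch. 7 §7.2.2 p. 168; lane plumbing] -/
private theorem fin5₉ (r : Fin 6) : r + 5 + 1 = r ∧ r + 5 + 2 = r + 1 ∧ r + 5 + 3 = r + 2 ∧ r + 1 + 5 = r ∧ r + 1 + 1 = r + 2 ∧ r + 0 = r := by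
  revert r; decide

/-! ## §1 The marked set with the two end marks and the three domains -/

omit T in
/-- `dP ≠ dQ` (heads `h ≠ h + e_{r+m}`). [cite: BollobasRiordan2006, Ch. 7 §7.2.2 p. 169; lane plumbing] -/
theorem dP_ne_dQ : slideP h r ≠ slideQ h r m := fun e => add_triDir_ne h (r + m) (congrArg Prod.snd e).symm

/-- the card of the marked set `S₀ ∪ {dP, dQ}`. [cite: BollobasRiordan2006, Ch. 7 §7.2.2 p. 169; lane plumbing] -/
theorem card_insert₂ : #(insert (slideP h r) (insert (slideQ h r m) S₀)) = #S₀ + 2 := by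
  rw [Finset.card_insert_of_notMem (by rw [Finset.mem_insert, not_or]; exact ⟨dP_ne_dQ, T.dP_da_not_mem.1⟩), Finset.card_insert_of_notMem T.dQ_not_mem]

/-- its darts are markable in `G`. [cite: BollobasRiordan2006, Ch. 7 §7.2.2 p. 169] -/
theorem markable₂ : ∀ d ∈ insert (slideP h r) (insert (slideQ h r m) S₀), IsMarkable (D₀.rebase₀ T.bz_mem).verts d := by
  intro d hd
  rcases Finset.mem_insert.1 hd with rfl | hd
  · exact T.isMarkable_dP
  rcases Finset.mem_insert.1 hd with rfl | hd
  · exact T.isMarkable_dQ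
  · exact T.mark d hd

/-- its tails are pairwise distinct (`dP`, `dQ` sit on different contact cells, the common marks off both). [cite: BollobasRiordan2006, Ch. 7 §7.2.2 p. 169 (distinct marked sites)] -/
theorem injOn₂ : Set.InjOn Prod.fst ((insert (slideP h r) (insert (slideQ h r m) S₀) : Finset (Site 2 × Site 2)) : Set (Site 2 × Site 2)) := by
  have hPQ : (slideP h r).1 ≠ (slideQ h r m).1 := by
    intro e
    have e' : triDir (r + 5) = triDir (r + (m + 1)) := add_left_cancel e
    have := triDir_injective e'
    rw [add_right_inj] at this
    exact (finm₉ m T.m_le).2.2.1 this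
  intro d hd d' hd' e
  rw [Finset.coe_insert, Finset.coe_insert, Set.mem_insert_iff, Set.mem_insert_iff] at hd hd'
  rcases hd with rfl | rfl | hd <;> rcases hd' with rfl | rfl | hd'
  · rfl
  · exact absurd e hPQ
  · exact absurd e.symm (T.fst_ne d' hd').2
  · exact absurd e.symm hPQ
  · rfl
  · exact absurd e.symm (T.fst_ne d' hd').1
  · exact absurd e (T.fst_ne d hd).2
  · exact absurd e (T.fst_ne d hd).1
  · exact T.inj hd hd' e

/-- the common marks are markable in the rebased `G`. [cite: BollobasRiordan2006, Ch. 7 §7.2.2 p. 169] -/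
theorem markable₀ : ∀ d ∈ S₀, IsMarkable (D₀.rebase₀ T.bz_mem).verts d := fun d hd => T.mark d hd

/-- … and in the rebased `G'`. [cite: BollobasRiordan2006, Ch. 7 §7.2.2 p. 169] -/
theorem markable₀' : ∀ d ∈ S₀, IsMarkable (D₀'.rebase₀ T.bz_mem'.1).verts d := fun d hd => T.mark' d hd

variable (n : ℕ) (hn : #S₀ = n + 1)

/-- **the small domain `D = (Ω; M)`**: `G` rebased at `bz`, marked at `S₀`. [cite: BollobasRiordan2006, Ch. 7 §7.2.2 pp. 168–169; KhristoforovSmirnov2021, §1.2 (arXiv v1 p. 2)] -/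
noncomputable def dom0 : TriMarkedDomain (n + 1) :=
  (D₀.rebase₀ T.bz_mem).ofDarts (Nat.succ_pos n) S₀ hn T.markable₀ T.inj

/-- **the big domain `D' = (Ω ∪ h; M)`**: `G'` rebased at `bz`, marked at `S₀`. [cite: BollobasRiordan2006, Ch. 7 §7.2.2 pp. 168–169; KhristoforovSmirnov2021, §1.2 (arXiv v1 p. 2)] -/
noncomputable def dom0' : TriMarkedDomain (n + 1) :=
  (D₀'.rebase₀ T.bz_mem'.1).ofDarts (Nat.succ_pos n) S₀ hn T.markable₀' T.inj

/-- **the doubly-marked small domain `E = (Ω; M + p + q)`**: `G` rebased at `bz`, marked at `S₀ ∪ {dP, dQ}`.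
[cite: BollobasRiordan2006, Ch. 7 §7.2.2 pp. 168–169; KhristoforovSmirnov2021, §1.2 (arXiv v1 p. 2)] -/
noncomputable def domPQ : TriMarkedDomain (n + 1 + 1 + 1) :=
  (D₀.rebase₀ T.bz_mem).ofDarts (by omega) (insert (slideP h r) (insert (slideQ h r m) S₀)) (by rw [T.card_insert₂, hn]) T.markable₂ T.injOn₂

/-- their sites. [cite: BollobasRiordan2006, Ch. 7 §7.2.2 p. 168; lane plumbing] -/
theorem verts₀ : (T.dom0 n hn).verts = D₀.verts ∧ (T.dom0' n hn).verts = D₀'.verts ∧ (T.domPQ n hn).verts = D₀.verts := ⟨rfl, rfl, rfl⟩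

/-! ## §2 `D` and `D'` have the same marks and the same corner faces -/

/-- ★ **the marks of `D'` are those of `D`** (common darts compare identically in `G` and `G'`, «ATTACH-ORDER»). [cite: BollobasRiordan2006, Ch. 7 §7.2.2 p. 169 (marked sites in anticlockwise order)] -/
theorem markDart_dom0'_eq (i : Fin (n + 1)) : (T.dom0' n hn).markDart i = (T.dom0 n hn).markDart i := by
  have R := T.removableAt
  set E' := D₀'.rebase₀ T.bz_mem'.1 with hE'
  set E := D₀.rebase₀ T.bz_mem with hE
  have R' : RemovableAt E'.verts h r (m + 1) := R
  have hV : E.verts = E'.verts.erase h := T.verts_eq_erase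
  have hB : E.base = E'.base := rfl
  have hbP : E'.base ≠ RemovableAt.dPlus h r (m + 1) := by rw [← T.dQ_eq_dPlus]; exact T.bz_ne
  have hcom : ∀ d ∈ S₀, d ∈ triBdryDarts D₀'.verts ∧ d.1 ≠ h := fun d hd => T.mem'_of_mem hd
  have key := ofDarts_markDart_eq_of_orderIso (D := E) (D' := E') (Nat.succ_pos n) hn T.markable₀ T.inj hn T.markable₀' T.inj id (fun d hd => hd)
    (fun d hd d' hd' hlt => (dpos_lt_dpos_iff_of_common R' hV hB T.bz_mem'.2 hbP (hcom d hd).1 (hcom d hd).2 (hcom d' hd').1 (hcom d' hd').2).2 hlt) i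
  exact key

/-- the marks are common marks. [cite: BollobasRiordan2006, Ch. 7 §7.2.2 p. 169] -/
theorem markDart_dom0_mem (i : Fin (n + 1)) : (T.dom0 n hn).markDart i ∈ S₀ :=
  ofDarts_markDart_mem _ _ _ _ _ _ i

/-- **a common mark has the same predecessor dart in `G'` and in `G`.** [cite: BollobasRiordan2006, Ch. 7 §7.2.2 p. 169 (marked at the second outside neighbour)] -/
theorem predDart_dom0'_eq (i : Fin (n + 1)) : predDart (T.dom0' n hn) i = predDart (T.dom0 n hn) i := by
  have R := T.removableAt
  have F := finm₉ m T.m_le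
  have hS := T.markDart_dom0_mem n hn i
  have hA := T.markDart_dom0'_eq n hn i
  set d := (T.dom0 n hn).markDart i with hd
  set d₁ := predDart (T.dom0 n hn) i with hd₁
  have hd₁m : d₁ ∈ triBdryDarts D₀.verts := predDart_mem (T.dom0 n hn) i
  have hsucc : triBdrySucc D₀.verts d₁ = d := succ_predDart (T.dom0 n hn) i
  obtain ⟨hx, hy, hadj⟩ := mem_triBdryDarts.1 hd₁m
  have hd2 : d.2 ≠ h := (T.sub d hS).2
  -- the head of `d₁` is not `h`: otherwise `d₁ = nw t` and its successor has head `h` or is `dQ`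
  have hd₁2 : d₁.2 ≠ h := by
    intro e
    obtain ⟨j, hj⟩ := (triGraph_adj_iff_triDir d₁.2 d₁.1).1 hadj.symm
    rw [e] at hj
    obtain ⟨t, rfl⟩ : ∃ t : Fin 6, j = r + t := ⟨j - r, by rw [add_sub_cancel]⟩
    have hd₁eq : d₁ = RemovableAt.nw h r t := Prod.ext hj e
    have ht : (m + 1).val ≤ t.val := by
      by_contra hlt
      exact (R.out (t := t) (by omega)) (by rw [T.verts']; exact Finset.mem_insert_of_mem (hj ▸ hx))
    rw [hd₁eq, T.verts_eq_erase] at hsucc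
    rcases (Nat.lt_or_eq_of_le ht) with hlt | heq
    · rw [R.succ_erase_nw hlt] at hsucc
      exact hd2 (by rw [← hsucc]; rfl)
    · have htm : t = m + 1 := (Fin.ext heq).symm
      rw [htm, R.succ_erase_nw_last, ← T.dQ_eq_dPlus] at hsucc
      exact T.dQ_not_mem (hsucc ▸ hS)
  have hd₁' : d₁ ∈ triBdryDarts D₀'.verts := by
    refine mem_triBdryDarts.2 ⟨by rw [T.verts']; exact Finset.mem_insert_of_mem hx, ?_, hadj⟩
    rw [T.verts', Finset.mem_insert, not_or]; exact ⟨hd₁2, hy⟩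
  -- `d₁ ≠ dMinus` (whose `G`-successor is `dP`, head `h`)
  have hdm : d₁ ≠ RemovableAt.dMinus h r := by
    intro e
    rw [e, T.verts_eq_erase, RemovableAt.succ_erase_dMinus] at hsucc
    exact hd2 (by rw [← hsucc]; rfl)
  have hsucc' : triBdrySucc D₀'.verts d₁ = (T.dom0' n hn).markDart i := by
    rw [hA, ← hsucc, T.verts_eq_erase]
    exact (R.succ_erase_eq hd₁' hdm).symm
  exact (T.dom0' n hn).predDart_eq_of_succ_eq i hd₁' hsucc'

/-- ★ **the corner faces of `D'` and `D` agree.** [cite: KhristoforovSmirnov2021, §1.2 (arXiv v1 p. 2: the corner disorders); BollobasRiordan2006, Ch. 7 §7.2.2 p. 169] -/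
theorem yc_dom0'_eq (i : Fin (n + 1)) : yc (T.dom0' n hn) i = yc (T.dom0 n hn) i := by
  apply eq_yc
  unfold IsCornerFace
  rw [yc_spec (T.dom0' n hn) i, TriMarkedDomain.markSite, TriMarkedDomain.markSite, T.markDart_dom0'_eq n hn i, T.predDart_dom0'_eq n hn i]

/-- ★★ **`D'` IS `D` WITH THE HEXAGON `h` ATTACHED AND NO MARK ON IT.** [cite: KhristoforovSmirnov2021, §1.2 (arXiv v1 p. 2); BollobasRiordan2006, Ch. 7 §7.2.2 pp. 168–169] -/
theorem attachData : AttachData (T.dom0' n hn) (T.dom0 n hn) h r m where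
  verts' := T.verts'
  not_mem := T.not_mem
  out := T.out
  inside := T.inside
  m_le := (finm₉ m T.m_le).2.2.2.1
  yc_eq := T.yc_dom0'_eq n hn

/-! ## §3 The marks of `E`: the common marks, with `dP, dQ` inserted as two adjacent corners -/

/-- **the insertion index**: the number of common marks numbered before `dP` (equivalently before `dQ`). [cite: BollobasRiordan2006, Ch. 7 §7.2.2 p. 169; lane tool notion] -/
noncomputable def jIns : Fin (n + 1 + 1) :=
  ⟨#((Finset.univ : Finset (Fin (n + 1))).filter fun i =>
      (D₀.rebase₀ T.bz_mem).dpos ((T.dom0 n hn).markDart i) < (D₀.rebase₀ T.bz_mem).dpos (slideP h r)),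
    Nat.lt_succ_of_le ((Finset.card_filter_le _ _).trans (by rw [Finset.card_univ, Fintype.card_fin]))⟩

/-- the common marks are numbered increasingly by position. [cite: BollobasRiordan2006, Ch. 7 §7.2.2 p. 169] -/
theorem dpos_markDart_dom0_strictMono : StrictMono fun i => (D₀.rebase₀ T.bz_mem).dpos ((T.dom0 n hn).markDart i) := by
  intro a b hab
  show (D₀.rebase₀ T.bz_mem).dpos ((T.dom0 n hn).markDart a) < (D₀.rebase₀ T.bz_mem).dpos ((T.dom0 n hn).markDart b)
  unfold dom0
  rw [dpos_ofDarts_markDart, dpos_ofDarts_markDart]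
  exact dartPos_strictMono _ _ _ hab

/-- ★ **a common mark is numbered before `dP` iff its index is below the insertion index.** [cite: BollobasRiordan2006, Ch. 7 §7.2.2 p. 169] -/
theorem dpos_markDart_lt_dP_iff (i : Fin (n + 1)) :
    (D₀.rebase₀ T.bz_mem).dpos ((T.dom0 n hn).markDart i) < (D₀.rebase₀ T.bz_mem).dpos (slideP h r) ↔ i.val < (T.jIns n hn).val := by
  classical
  have hmono := T.dpos_markDart_dom0_strictMono n hn
  set A := (Finset.univ : Finset (Fin (n + 1))).filter fun i =>
      (D₀.rebase₀ T.bz_mem).dpos ((T.dom0 n hn).markDart i) < (D₀.rebase₀ T.bz_mem).dpos (slideP h r) with hA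
  show _ ↔ i.val < #A
  constructor
  · intro hi
    have hsub : Finset.Iic i ⊆ A := by
      intro i' hi'
      rw [Finset.mem_Iic] at hi'
      exact Finset.mem_filter.2 ⟨Finset.mem_univ _, lt_of_le_of_lt (hmono.monotone hi') hi⟩
    have := Finset.card_le_card hsub
    rw [Fin.card_Iic] at this
    omega
  · intro hi
    by_contra hnot
    have hsub : A ⊆ Finset.Iio i := by
      intro i' hi'
      rw [Finset.mem_Iio]
      by_contra hle
      exact hnot (lt_of_le_of_lt (hmono.monotone (not_lt.1 hle)) (Finset.mem_filter.1 hi').2)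
    have := Finset.card_le_card hsub
    rw [Fin.card_Iio] at this
    omega

/-- positions: `dP` strictly before `dQ`, and a common mark is before `dQ` iff before `dP`. [cite: BollobasRiordan2006, Ch. 7 §7.2.2 p. 168 (the boundary cycle)] -/
theorem dpos_dP_lt_dQ : (D₀.rebase₀ T.bz_mem).dpos (slideP h r) < (D₀.rebase₀ T.bz_mem).dpos (slideQ h r m) ∧
    ∀ d ∈ S₀, ((D₀.rebase₀ T.bz_mem).dpos d < (D₀.rebase₀ T.bz_mem).dpos (slideQ h r m) ↔ (D₀.rebase₀ T.bz_mem).dpos d < (D₀.rebase₀ T.bz_mem).dpos (slideP h r)) := by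
  set E := D₀.rebase₀ T.bz_mem with hE
  have hinj : ∀ d d' : Site 2 × Site 2, d ∈ triBdryDarts E.verts → d' ∈ triBdryDarts E.verts → E.dpos d = E.dpos d' → d = d' := by
    intro d d' h1 h2 e; rw [← E.iter_dpos h1, ← E.iter_dpos h2, e]
  have h1 := T.dpos_lt_dQ_iff_lt_dP T.bz_mem'.1 T.bz_mem'.2
  refine ⟨lt_of_le_of_ne h1.2 fun e => dP_ne_dQ (hinj _ _ T.isMarkable_dP.mem T.isMarkable_dQ.mem e), fun d hd => ?_⟩
  exact (T.dpos_lt_dQ_iff_lt_dP (T.mem'_of_mem hd).1 (T.mem'_of_mem hd).2).1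

/-- **the enumeration of the marks of `E`**: `dP` at the insertion index, `dQ` right after, the common marks around (relabelled by `skip`). [cite: BollobasRiordan2006, Ch. 7 §7.2.2 p. 169] -/
noncomputable def insFun (i : Fin (n + 1 + 1 + 1)) : Site 2 × Site 2 :=
  if h1 : i = Fin.castSucc (T.jIns n hn) then slideP h r else if h2 : i = (T.jIns n hn).succ then slideQ h r m
    else (T.dom0 n hn).markDart (unskip (T.jIns n hn) i h1 h2)

/-- values of the enumeration. [cite: BollobasRiordan2006, Ch. 7 §7.2.2 p. 169; lane plumbing] -/
theorem insFun_apply : T.insFun n hn (Fin.castSucc (T.jIns n hn)) = slideP h r ∧ T.insFun n hn (T.jIns n hn).succ = slideQ h r m ∧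
    ∀ x, T.insFun n hn (skip (T.jIns n hn) x) = (T.dom0 n hn).markDart x := by
  have hjs : (T.jIns n hn).succ ≠ Fin.castSucc (T.jIns n hn) := (ne_of_lt Fin.castSucc_lt_succ).symm
  refine ⟨by unfold insFun; rw [dif_pos rfl], by unfold insFun; rw [dif_neg hjs, dif_pos rfl], fun x => ?_⟩
  unfold insFun
  rw [dif_neg (skip_ne_castSucc _ x), dif_neg (skip_ne_succ _ x), unskip_skip]

omit T in
/-- `skip j x` is below `j⁺` iff `x` is below `j`. [cite: PearceRittenbergDeGierNienhuis2002, §2 (link diagrams); lane plumbing] -/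
theorem skip_lt_castSucc_iff (j : Fin (n + 1 + 1)) (x : Fin (n + 1)) : skip j x < Fin.castSucc j ↔ x.val < j.val := by
  rw [Fin.lt_def, skip_val, Fin.val_castSucc]
  split_ifs <;> omega

/-- ★ **the enumeration is strictly increasing in position.** [cite: BollobasRiordan2006, Ch. 7 §7.2.2 p. 169 (marked sites in anticlockwise order)] -/
theorem insFun_strictMono : StrictMono fun i => (D₀.rebase₀ T.bz_mem).dpos (T.insFun n hn i) := by
  set E := D₀.rebase₀ T.bz_mem with hE
  set j := T.jIns n hn with hj
  have hmono := T.dpos_markDart_dom0_strictMono n hn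
  obtain ⟨hPQ, hQP⟩ := T.dpos_dP_lt_dQ
  obtain ⟨eP, eQ, eS⟩ := T.insFun_apply n hn
  have hinj : ∀ d d' : Site 2 × Site 2, d ∈ triBdryDarts E.verts → d' ∈ triBdryDarts E.verts → E.dpos d = E.dpos d' → d = d' := by
    intro d d' h1 h2 e; rw [← E.iter_dpos h1, ← E.iter_dpos h2, e]
  have hS : ∀ x, (T.dom0 n hn).markDart x ∈ S₀ := T.markDart_dom0_mem n hn
  -- position of a common mark relative to `dP` / `dQ`
  have aboveP : ∀ x, ¬ x.val < j.val → E.dpos (slideP h r) < E.dpos ((T.dom0 n hn).markDart x) := by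
    intro x hx
    have h1 : ¬ E.dpos ((T.dom0 n hn).markDart x) < E.dpos (slideP h r) := fun h' => hx ((T.dpos_markDart_lt_dP_iff n hn x).1 h')
    have h2 : E.dpos ((T.dom0 n hn).markDart x) ≠ E.dpos (slideP h r) := fun e =>
      T.dP_da_not_mem.1 ((hinj _ _ (T.mark _ (hS x)).mem T.isMarkable_dP.mem e) ▸ hS x)
    omega
  have aboveQ : ∀ x, ¬ x.val < j.val → E.dpos (slideQ h r m) < E.dpos ((T.dom0 n hn).markDart x) := by
    intro x hx
    have h1 : ¬ E.dpos ((T.dom0 n hn).markDart x) < E.dpos (slideQ h r m) := fun h' =>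
      hx ((T.dpos_markDart_lt_dP_iff n hn x).1 ((hQP _ (hS x)).1 h'))
    have h2 : E.dpos ((T.dom0 n hn).markDart x) ≠ E.dpos (slideQ h r m) := fun e =>
      T.dQ_not_mem ((hinj _ _ (T.mark _ (hS x)).mem T.isMarkable_dQ.mem e) ▸ hS x)
    omega
  have belowP : ∀ x, x.val < j.val → E.dpos ((T.dom0 n hn).markDart x) < E.dpos (slideP h r) := fun x hx => (T.dpos_markDart_lt_dP_iff n hn x).2 hx
  intro a b hab
  simp only
  rcases eq_castSucc_or_succ_or_skip j a with rfl | rfl | ⟨x, rfl⟩ <;> rcases eq_castSucc_or_succ_or_skip j b with rfl | rfl | ⟨y, rfl⟩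
  · exact absurd hab (lt_irrefl _)
  · rw [eP, eQ]; exact hPQ
  · rw [eP, eS]
    have hy : ¬ y.val < j.val := fun h' => lt_asymm hab ((skip_lt_castSucc_iff n j y).2 h')
    exact aboveP y hy
  · exact absurd (hab.trans Fin.castSucc_lt_succ) (lt_irrefl _)
  · exact absurd hab (lt_irrefl _)
  · rw [eQ, eS]
    have hy : ¬ y.val < j.val := fun h' => lt_asymm (hab.trans' Fin.castSucc_lt_succ) ((skip_lt_castSucc_iff n j y).2 h')
    exact aboveQ y hy
  · rw [eS, eP]
    exact belowP x ((skip_lt_castSucc_iff n j x).1 hab)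
  · rw [eS, eQ]
    have hx : x.val < j.val := by
      have h1 : skip j x ≤ Fin.castSucc j := Fin.le_castSucc_iff.2 hab
      exact (skip_lt_castSucc_iff n j x).1 (lt_of_le_of_ne h1 (skip_ne_castSucc j x))
    exact (belowP x hx).trans hPQ
  · rw [eS, eS]
    exact hmono ((skip_lt_iff j).1 hab)

/-- ★★ **THE MARKS OF `E`**: the enumeration `insFun`. [cite: BollobasRiordan2006, Ch. 7 §7.2.2 p. 169 (marked sites in anticlockwise order); KhristoforovSmirnov2021, §1.2 (arXiv v1 p. 2)] -/
theorem markDart_domPQ (i : Fin (n + 1 + 1 + 1)) : (T.domPQ n hn).markDart i = T.insFun n hn i := by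
  refine ofDarts_markDart_eq_of_strictMono _ _ _ _ _ _ (T.insFun n hn) (fun i => ?_) (T.insFun_strictMono n hn) i
  rcases eq_castSucc_or_succ_or_skip (T.jIns n hn) i with rfl | rfl | ⟨x, rfl⟩
  · rw [(T.insFun_apply n hn).1]; exact Finset.mem_insert_self _ _
  · rw [(T.insFun_apply n hn).2.1]; exact Finset.mem_insert_of_mem (Finset.mem_insert_self _ _)
  · rw [(T.insFun_apply n hn).2.2 x]; exact Finset.mem_insert_of_mem (Finset.mem_insert_of_mem (T.markDart_dom0_mem n hn x))

/-- ★ the two end marks sit at the adjacent indices `j, j+1`, the common marks at `skip j`. [cite: KhristoforovSmirnov2021, §1.2 (arXiv v1 p. 2); BollobasRiordan2006, Ch. 7 §7.2.2 p. 169] -/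
theorem markDart_domPQ_eq : (T.domPQ n hn).markDart (Fin.castSucc (T.jIns n hn)) = slideP h r ∧ (T.domPQ n hn).markDart (T.jIns n hn).succ = slideQ h r m ∧
    ∀ x, (T.domPQ n hn).markDart (skip (T.jIns n hn) x) = (T.dom0 n hn).markDart x := by
  refine ⟨?_, ?_, fun x => ?_⟩
  · rw [T.markDart_domPQ n hn, (T.insFun_apply n hn).1]
  · rw [T.markDart_domPQ n hn, (T.insFun_apply n hn).2.1]
  · rw [T.markDart_domPQ n hn, (T.insFun_apply n hn).2.2 x]

/-! ## §4 The corner faces of `E` -/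

/-- ★ **the common corner faces of `E` are those of `D`, relabelled by `skip`.** [cite: KhristoforovSmirnov2021, §1.2 (arXiv v1 p. 2: the corner disorders)] -/
theorem yc_domPQ_skip (x : Fin (n + 1)) : yc (T.domPQ n hn) (skip (T.jIns n hn) x) = yc (T.dom0 n hn) x := by
  have hmark := (T.markDart_domPQ_eq n hn).2.2 x
  have hpred : predDart (T.domPQ n hn) (skip (T.jIns n hn) x) = predDart (T.dom0 n hn) x :=
    (T.domPQ n hn).predDart_eq_of_succ_eq _ (predDart_mem (T.dom0 n hn) x) (by rw [hmark]; exact succ_predDart (T.dom0 n hn) x)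
  apply eq_yc
  unfold IsCornerFace
  rw [yc_spec (T.domPQ n hn) _, TriMarkedDomain.markSite, TriMarkedDomain.markSite, hmark, hpred]

/-- ★ **the two new corner faces of `E`: `P = N_{r+5}` at `j`, `Q = N_{r+m}` at `j+1`.** [cite: KhristoforovSmirnov2021, §1.2 (arXiv v1 p. 2: the corner disorders); BollobasRiordan2006, Ch. 7 §7.2.2 p. 169] -/
theorem yc_domPQ_ends : yc (T.domPQ n hn) (Fin.castSucc (T.jIns n hn)) = leftFaceDir h (r + 5) ∧ yc (T.domPQ n hn) (T.jIns n hn).succ = leftFaceDir h (r + m) := by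
  have F := finm₉ m T.m_le
  have F5 := fin5₉ r
  obtain ⟨hP, hQ, -⟩ := T.markDart_domPQ_eq n hn
  constructor
  · -- `dP = (g, g + e_{(r+1)+1})`, `g = h + e_{r+5}`, `g + e_{r+1} = h + e_r`
    have e2 : h + triDir (r + 5) + triDir (r + 1 + 1) = h := by
      rw [F5.2.2.2.2.1, add_assoc h, ← F5.2.2.1, triDir_add_three, add_neg_cancel, add_zero]
    have e1 : h + triDir (r + 5) + triDir (r + 1) = h + triDir r := by
      rw [add_assoc h, ← F5.2.1, triDir_add_triDir_add_two, F5.1]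
    have h0 : h + triDir r ∉ D₀.verts := by have := T.out 0 (Fin.zero_le _); rwa [add_zero] at this
    have hmark : (T.domPQ n hn).markDart (Fin.castSucc (T.jIns n hn)) = (h + triDir (r + 5), h + triDir (r + 5) + triDir (r + 1 + 1)) := by rw [hP, e2]; rfl
    rw [yc_eq_leftFaceDir (T.domPQ n hn) _ hmark (by rw [e1]; exact h0), ← F5.2.1]
    exact leftFaceDir_add_triDir h (r + 5)
  · -- `dQ = (g, g + e_{J+1})`, `J = r + m + 4`, `g + e_J = h`
    have eJ : h + triDir (r + (m + 1)) + triDir (r + (m + 4)) = h := by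
      rw [add_assoc h, show r + (m + 4) = r + (m + 1) + 3 by rw [add_assoc r, add_assoc m]; rfl, triDir_add_three, add_neg_cancel, add_zero]
    have eJ1 : h + triDir (r + (m + 1)) + triDir (r + (m + 4) + 1) = h + triDir (r + m) := by
      rw [show r + (m + 4) + 1 = r + (m + 1) + 4 by abel, add_triDir_add_triDir_add_four, add_assoc r, F.2.2.2.2]
    have hmark : (T.domPQ n hn).markDart (T.jIns n hn).succ = (h + triDir (r + (m + 1)), h + triDir (r + (m + 1)) + triDir (r + (m + 4) + 1)) := by
      rw [hQ, eJ1]; rfl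
    rw [yc_eq_leftFaceDir (T.domPQ n hn) _ hmark (by rw [eJ]; exact T.not_mem), show r + (m + 4) = r + m + 4 by rw [add_assoc],
      show r + (m + 1) = r + m + 1 by rw [add_assoc]]
    exact leftFaceDir_contactQ h (r + m)

/-- ★★ **`E` IS `D` MARKED ADDITIONALLY AT THE TWO END FACES, AS THE ADJACENT CORNERS `j, j+1`.** [cite: KhristoforovSmirnov2021, §1.2 (arXiv v1 pp. 2–3); BollobasRiordan2006, Ch. 7 §7.2.2 pp. 168–169] -/
theorem marksData : MarksData (T.dom0 n hn) (T.domPQ n hn) h r m (T.jIns n hn) where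
  verts := rfl
  yc_skip := T.yc_domPQ_skip n hn
  yc_pair := Or.inl (T.yc_domPQ_ends n hn)

/-! ## §5 The observed mid-edge lies on the home stretch of the three domains; the identity -/

omit T in
/-- the base dart of numbering is not a mark, so the first mark has positive position. [cite: BollobasRiordan2006, Ch. 7 §7.2.2 p. 169; lane plumbing] -/
private theorem dartPos_zero_pos_of_notMem (E : TriMarkedDomain 0) (hb : E.base = bz) {k : ℕ} (hk : 0 < k) (S : Finset (Site 2 × Site 2)) (hc : #S = k)
    (hS : ∀ d ∈ S, IsMarkable E.verts d) (hi : Set.InjOn Prod.fst (S : Set (Site 2 × Site 2))) (hbz : bz ∉ S) :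
    0 < E.dartPos S (E.card_visitTimes_of_markable _ hc hS) ⟨0, hk⟩ := by
  rw [← E.dpos_ofDarts_markDart hk S hc hS hi]
  by_contra h0
  have e : E.dpos ((E.ofDarts hk S hc hS hi).markDart ⟨0, hk⟩) = 0 := by omega
  have hm := E.ofDarts_markDart_mem hk S hc hS hi ⟨0, hk⟩
  have := E.iter_dpos (hS _ hm).mem
  rw [e, triBdryIter_zero, hb] at this
  exact hbz (this ▸ hm)

/-- ★ **the observed dart lies on the HOME stretch of all three domains** (it is their base of numbering, before the first mark).
[cite: KhristoforovSmirnov2021, §2 eq. (4) and Remark 6 (arXiv v1 p. 5: `z` on a boundary arc); BollobasRiordan2006, Ch. 7 §7.2.2 p. 169] -/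
theorem bz_mem_stretch₀ : bz ∈ (T.dom0 n hn).stretch (Fin.last n) ∧ bz ∈ (T.dom0' n hn).stretch (Fin.last n) ∧ bz ∈ (T.domPQ n hn).stretch (Fin.last (n + 1 + 1)) := by
  have hbS : bz ∉ S₀ := T.bz_not_mem
  have hbS₂ : bz ∉ insert (slideP h r) (insert (slideQ h r m) S₀) := by
    rw [Finset.mem_insert, Finset.mem_insert, not_or, not_or]
    exact ⟨fun e => T.bz_snd (by rw [e]; rfl), T.bz_ne, hbS⟩
  have hl : ¬ (Fin.last n).val + 1 < n + 1 := by simp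
  have hl₂ : ¬ (Fin.last (n + 1 + 1)).val + 1 < n + 1 + 1 + 1 := by simp
  have h0 : (D₀.rebase₀ T.bz_mem).dpos bz = 0 := (D₀.rebase₀ T.bz_mem).dpos_eq_of_iter_eq (D₀.rebase₀ T.bz_mem).isTriDisc.card_pos rfl
  have h0' : (D₀'.rebase₀ T.bz_mem'.1).dpos bz = 0 := (D₀'.rebase₀ T.bz_mem'.1).dpos_eq_of_iter_eq (D₀'.rebase₀ T.bz_mem'.1).isTriDisc.card_pos rfl
  refine ⟨?_, ?_, ?_⟩
  · unfold dom0
    rw [mem_stretch_ofDarts_last_iff _ _ _ _ _ _ _ hl]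
    exact ⟨T.bz_mem, Or.inr (by rw [h0]; exact dartPos_zero_pos_of_notMem _ rfl _ _ hn T.markable₀ T.inj hbS)⟩
  · unfold dom0'
    rw [mem_stretch_ofDarts_last_iff _ _ _ _ _ _ _ hl]
    exact ⟨T.bz_mem'.1, Or.inr (by rw [h0']; exact dartPos_zero_pos_of_notMem _ rfl _ _ hn T.markable₀' T.inj hbS)⟩
  · unfold domPQ
    rw [mem_stretch_ofDarts_last_iff _ _ _ _ _ _ _ hl₂]
    exact ⟨T.bz_mem, Or.inr (by rw [h0]; exact dartPos_zero_pos_of_notMem _ rfl _ _ (by rw [T.card_insert₂, hn]) T.markable₂ T.injOn₂ hbS₂)⟩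

/-- **the observed mid-edge in `D`.** [cite: KhristoforovSmirnov2021, §2 eq. (4) and Remark 6 (arXiv v1 p. 5)] -/
noncomputable def arcPoint0 : ArcPoint (T.dom0 n hn) (Fin.last n) :=
  ArcPoint.ofFlatDart (g := bz.1) (o := bz.2) (T.bz_mem_stretch₀ n hn).1 T.flat.1 T.flat.2

/-- **the observed mid-edge in `D'`.** [cite: KhristoforovSmirnov2021, §2 eq. (4) and Remark 6 (arXiv v1 p. 5)] -/
noncomputable def arcPoint0' : ArcPoint (T.dom0' n hn) (Fin.last n) :=
  ArcPoint.ofFlatDart (g := bz.1) (o := bz.2) (T.bz_mem_stretch₀ n hn).2.1 (by rw [(T.verts₀ n hn).2.1, T.verts']; exact Finset.mem_insert_of_mem T.flat.1)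
    (by rw [(T.verts₀ n hn).2.1, T.verts']; exact Finset.mem_insert_of_mem T.flat.2)

/-- **the observed mid-edge in `E`.** [cite: KhristoforovSmirnov2021, §2 eq. (4) and Remark 6 (arXiv v1 p. 5)] -/
noncomputable def arcPointPQ : ArcPoint (T.domPQ n hn) (Fin.last (n + 1 + 1)) :=
  ArcPoint.ofFlatDart (g := bz.1) (o := bz.2) (T.bz_mem_stretch₀ n hn).2.2 T.flat.1 T.flat.2

/-- the three mid-edges are read at the same face and side. [cite: KhristoforovSmirnov2021, §2 eq. (4) (arXiv v1 p. 5); lane plumbing] -/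
theorem arcPoint_v_i₀ : (T.arcPoint0' n hn).v = (T.arcPoint0 n hn).v ∧ (T.arcPoint0' n hn).i = (T.arcPoint0 n hn).i ∧ (T.arcPointPQ n hn).v = (T.arcPoint0 n hn).v ∧
    (T.arcPointPQ n hn).i = (T.arcPoint0 n hn).i := by
  have hv' : (T.arcPoint0' n hn).v = (T.arcPoint0 n hn).v := by unfold arcPoint0' arcPoint0; rw [ArcPoint.ofFlatDart_v, ArcPoint.ofFlatDart_v]
  have hvE : (T.arcPointPQ n hn).v = (T.arcPoint0 n hn).v := by unfold arcPointPQ arcPoint0; rw [ArcPoint.ofFlatDart_v, ArcPoint.ofFlatDart_v]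
  have hs0 : side (T.arcPoint0 n hn).v (T.arcPoint0 n hn).i = s(bz.1, bz.2) := by unfold arcPoint0; exact ArcPoint.side_ofFlatDart _ _ _
  have hs' : side (T.arcPoint0' n hn).v (T.arcPoint0' n hn).i = s(bz.1, bz.2) := by unfold arcPoint0'; exact ArcPoint.side_ofFlatDart _ _ _
  have hsE : side (T.arcPointPQ n hn).v (T.arcPointPQ n hn).i = s(bz.1, bz.2) := by unfold arcPointPQ; exact ArcPoint.side_ofFlatDart _ _ _
  refine ⟨hv', ?_, hvE, ?_⟩
  · apply side_injective (T.arcPoint0 n hn).v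
    rw [← hv', hs', hv', hs0]
  · apply side_injective (T.arcPoint0 n hn).v
    rw [← hvE, hsE, hvE, hs0]

/-- ★★★★ **F2, CONSTRUCTED: `lawLP z(Ω ∪ h; M) = lawLP z(Ω; M) + contractL j (lawLP z(Ω; M + p + q))`** in the planar Temperley–Lieb module — for ANY unmarked discrete domains
`Ω ⊂ Ω ∪ h` with `h` attached along a contact arc of 2–4 cells (first contact end a simple corner), any nonempty set of common marks `S₀` (markable in both, tails off the contact
ends' cells, not containing the `Q`-dart) and any flat common observed dart off the marks: the boundary link-pattern law of the big domain is the law of the small one plus the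
Temperley–Lieb CONTRACTION, at the insertion index, of the law of the small domain marked additionally at the two end faces of the outer path.
[cite: KhristoforovSmirnov2021, §1.2 (arXiv v1 p. 2: the law of the link pattern), §2 Definition 3 and Remark 6 (pp. 4–5); PearceRittenbergDeGierNienhuis2002, §2 (monoid:
contraction); BollobasRiordan2006, Ch. 7 §7.2.2 pp. 168–169] -/
theorem lawLP_eq_add_contractL :
    lawLP (T.arcPoint0' n hn) = lawLP (T.arcPoint0 n hn) + contractL ℂ (Fin.castSucc (T.jIns n hn)) (lawLP (T.arcPointPQ n hn)) :=
  (T.attachData n hn).lawLP_eq_add_contractL_lawLP (T.marksData n hn) (T.arcPoint0' n hn) (T.arcPoint0 n hn) (T.arcPointPQ n hn) (T.arcPoint_v_i₀ n hn).1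
    (T.arcPoint_v_i₀ n hn).2.1 (T.arcPoint_v_i₀ n hn).2.2.1 (T.arcPoint_v_i₀ n hn).2.2.2

end SlideDarts

end ContractOfDarts

end Literature.Probability.Percolation.MarkedLoops
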